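import Summits.QuantumFields.YangMills.Theorems.UnitScaleTiltProp7LineAvgTwoBlock
import HarnessLib

/-!
# Route `UnitScaleTilt`, crux K1 «MinimiserStabilityRegPr» (stmt-QuantumFields-19200), line «route-R» (`Lines/birth_routeR.lean` v2 5b75208179c6919a),
# stub P `stub_relPoincareOpt` — linear flat core, step N6-B2 of the P-lin-flat plan (CARD-19200-V3-g11): THE `k`-FOLD STRAIGHT AVERAGE `Q_k` IS
# `ℓ²`-CLOSE TO ANY CONSTANT THAT THE FIELD IS `ℓ²`-CLOSE TO ON THE TWO BLOCKS — `‖(Q_kX)(c) − C‖² ≤ 2L^{−kd}·Σ_{B^k(c₋) ∪ B^k(c₊)} ‖X − C‖²`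

Cell `ym3-torus` ∕ fleet seat `ym-ust-19200-p1` (gen 11, route-R lead).  WHY.  The `(H¹)^*`-bound of the structure theorem's gauge function (N6) is
«centre, then Poincaré»: N6-B1 (`Prop7CombMeanCentred`) reduced the per-level term `L^j·combMean(Q_jY)(z)` to the OSCILLATION of `Q_jY` around direction
constants on the level-`j` bonds of `B(z)`; this file bounds the oscillation of the tent two-block average `Q_j` ([Balaban1984PropagatorsI] (1.18),
`LatticeFieldCalculus.bondAvgIter`, two-block tent form `Prop7LineAvgRightInverse.sum_offsets_sum_range_runSite`) at ONE coarse bond by the `ℓ²`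
oscillation of the fine field on the two `k`-blocks of that bond — Jensen∕Cauchy–Schwarz with the tent weights `≤ L^k`; the cube Poincaré inequality
(N6-B3) then converts `ℓ²` oscillation into gradient energy at scale `L^{k+1}`.

WHAT IS PROVED (sorry-free, no definition; [folklore] on the tree's letters; any real normed space `V` of values):
* `bondAvgIter_eq_tent` — `Q_kX(c) = (L^{kd}L^k)⁻¹·(Σ_r (r_μ+1)·X(x_r) + Σ_r (L^k−1−r_μ)·X(x′_r))` (p454029 + p502715, values in `V`);
* `bondAvgIter_sub_const_eq_tent` — the same for `Q_kX(c) − C` with `X − C` (the tent weights sum to `L^{kd}L^k`);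
* **`norm_sq_bondAvgIter_sub_const_le`** — `‖Q_kX(c) − C‖² ≤ 2·L^{−kd}·(Σ_r ‖X(x_r) − C‖² + Σ_r ‖X(x′_r) − C‖²)`, `x_r`∕`x′_r` the fine `μ`-bonds at
  the sites of offset `r` of `B^k(c₋)`∕`B^k(c₊)`.

References: T. Bałaban, CMP 95 (1984) 17–40 [Balaban1984PropagatorsI] ((1.18) p.20); CMP 102 (1985) 277–309 [Balaban1985Variational] (Prop. 7 p.299).
-/

noncomputable section

open scoped BigOperators

namespace Summit.QuantumFields.YangMills.Theorems.Prop7BondAvgIterOsc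

open Literature.MathematicalPhysics.QuantumFieldTheory.Balaban1983to89
open Finset LatticeFieldCalculus B1RG242Torus
open Summit.QuantumFields.YangMills.Theorems.Prop7FlatCoercivity (bondAvgIter_eq_lineBlockAvg iterate_shift_eq_runSite sum_fibre_eq_sum_offsets)
open Summit.QuantumFields.YangMills.Theorems.Prop7LineAvgRightInverse (sum_offsets_sum_range_runSite)

variable {P : Params} {k : ℕ} {V : Type*} [NormedAddCommGroup V] [NormedSpace ℝ V]

/-- **THE TENT FORM OF `Q_k` WITH VALUES IN `V`**: `Q_kX(c) = (L^{kd}L^k)⁻¹·(Σ_r (r_μ+1)·X(⟨x_r, μ⟩) + Σ_r (L^k − 1 − r_μ)·X(⟨x′_r, μ⟩))`, `x_r = ` the site of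
offset `r` in `B^k(c₋)`, `x′_r` the one in `B^k(c₊)` (`c₊ = c₋ + e_μ`). [cite: Balaban1984PropagatorsI, (1.18) p.20] -/
theorem bondAvgIter_eq_tent (hk : k ≤ P.m + P.K) (h : P.sitesPerDir 0 = P.L ^ k * P.sitesPerDir k) (X : VecField P 0 V) (c : PBond P k) :
    bondAvgIter k X c = ((((P.L : ℝ) ^ k) ^ P.d * (P.L : ℝ) ^ k)⁻¹) •
      (∑ r : Fin P.d → Fin (P.L ^ k), ((r c.dir : ℕ) + 1) • X ⟨Site.fibreSite 0 k c.src r, c.dir⟩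
        + ∑ r : Fin P.d → Fin (P.L ^ k), (P.L ^ k - 1 - (r c.dir : ℕ)) • X ⟨Site.fibreSite 0 k (runSite c.src c.dir 1) r, c.dir⟩) := by
  rw [bondAvgIter_eq_lineBlockAvg hk X c, sum_fibre_eq_sum_offsets h]
  simp only [iterate_shift_eq_runSite]
  rw [sum_offsets_sum_range_runSite c.dir h c.src (fun z => X ⟨z, c.dir⟩)]

/-- The tent weights at one offset add up to `L^k`. [folklore] -/
theorem tent_weights_add (r : Fin P.d → Fin (P.L ^ k)) (μ : Fin P.d) : ((r μ : ℕ) + 1) + (P.L ^ k - 1 - (r μ : ℕ)) = P.L ^ k := by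
  have := (r μ).isLt
  omega

/-- **THE TENT FORM OF `Q_kX(c) − C`**: the tent weights sum to `L^{kd}·L^k`, so the constant may be moved inside.
[cite: Balaban1984PropagatorsI, (1.18) p.20] -/
theorem bondAvgIter_sub_const_eq_tent (hk : k ≤ P.m + P.K) (h : P.sitesPerDir 0 = P.L ^ k * P.sitesPerDir k) (X : VecField P 0 V)
    (c : PBond P k) (C : V) :
    bondAvgIter k X c - C = ((((P.L : ℝ) ^ k) ^ P.d * (P.L : ℝ) ^ k)⁻¹) •
      (∑ r : Fin P.d → Fin (P.L ^ k), ((r c.dir : ℕ) + 1) • (X ⟨Site.fibreSite 0 k c.src r, c.dir⟩ - C)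
        + ∑ r : Fin P.d → Fin (P.L ^ k), (P.L ^ k - 1 - (r c.dir : ℕ)) • (X ⟨Site.fibreSite 0 k (runSite c.src c.dir 1) r, c.dir⟩ - C)) := by
  set w : ℝ := ((((P.L : ℝ) ^ k) ^ P.d * (P.L : ℝ) ^ k)⁻¹) with hw
  have hL : (0 : ℝ) < (P.L : ℝ) := by exact_mod_cast P.L_pos
  have hN : (((P.L : ℝ) ^ k) ^ P.d * (P.L : ℝ) ^ k) ≠ 0 := by positivity
  -- the constant: `w • Σ_r (weights) • C = C`
  have hC : w • (∑ r : Fin P.d → Fin (P.L ^ k), ((r c.dir : ℕ) + 1) • C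
      + ∑ r : Fin P.d → Fin (P.L ^ k), (P.L ^ k - 1 - (r c.dir : ℕ)) • C) = C := by
    rw [← Finset.sum_add_distrib]
    have hterm : ∀ r : Fin P.d → Fin (P.L ^ k), ((r c.dir : ℕ) + 1) • C + (P.L ^ k - 1 - (r c.dir : ℕ)) • C = (P.L ^ k) • C := fun r => by
      rw [← add_smul, tent_weights_add]
    rw [Finset.sum_congr rfl fun r _ => hterm r, Finset.sum_const, Finset.card_univ, Fintype.card_fun, Fintype.card_fin, Fintype.card_fin,
      ← mul_smul, ← Nat.cast_smul_eq_nsmul ℝ, smul_smul, hw]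
    have : ((((P.L : ℝ) ^ k) ^ P.d * (P.L : ℝ) ^ k)⁻¹) * (((P.L ^ k) ^ P.d * P.L ^ k : ℕ) : ℝ) = 1 := by
      push_cast
      exact inv_mul_cancel₀ hN
    rw [this, one_smul]
  rw [bondAvgIter_eq_tent hk h X c]
  conv_lhs => rw [← hC]
  rw [← hw, ← smul_sub]
  congr 1
  simp only [smul_sub, Finset.sum_sub_distrib]
  abel

/-- **`‖Q_kX(c) − C‖² ≤ 2·L^{−kd}·(Σ_r ‖X(⟨x_r, μ⟩) − C‖² + Σ_r ‖X(⟨x′_r, μ⟩) − C‖²)`**: the tent two-block average is within `√2·L^{−kd/2}` times the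
`ℓ²` oscillation of the field on the two blocks of any constant (tent weights `≤ L^k`, Cauchy–Schwarz over the `2L^{kd}` sites).
[cite: Balaban1984PropagatorsI, (1.18) p.20] -/
theorem norm_sq_bondAvgIter_sub_const_le (hk : k ≤ P.m + P.K) (h : P.sitesPerDir 0 = P.L ^ k * P.sitesPerDir k) (X : VecField P 0 V)
    (c : PBond P k) (C : V) :
    ‖bondAvgIter k X c - C‖ ^ 2 ≤ 2 * (((P.L : ℝ) ^ k) ^ P.d)⁻¹ *
      (∑ r : Fin P.d → Fin (P.L ^ k), ‖X ⟨Site.fibreSite 0 k c.src r, c.dir⟩ - C‖ ^ 2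
        + ∑ r : Fin P.d → Fin (P.L ^ k), ‖X ⟨Site.fibreSite 0 k (runSite c.src c.dir 1) r, c.dir⟩ - C‖ ^ 2) := by
  set n : ℕ := P.L ^ k with hn
  set Nd : ℝ := ((P.L : ℝ) ^ k) ^ P.d with hNd
  set a : (Fin P.d → Fin (P.L ^ k)) → ℝ := fun r => ‖X ⟨Site.fibreSite 0 k c.src r, c.dir⟩ - C‖ with ha
  set b : (Fin P.d → Fin (P.L ^ k)) → ℝ := fun r => ‖X ⟨Site.fibreSite 0 k (runSite c.src c.dir 1) r, c.dir⟩ - C‖ with hb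
  have hL : (0 : ℝ) < (P.L : ℝ) := by exact_mod_cast P.L_pos
  have hnR : (n : ℝ) = (P.L : ℝ) ^ k := by rw [hn]; push_cast; rfl
  have hn0 : (0 : ℝ) < n := by rw [hnR]; positivity
  have hNd0 : 0 < Nd := by positivity
  have hcard : (Fintype.card (Fin P.d → Fin (P.L ^ k)) : ℝ) = Nd := by
    rw [Fintype.card_fun, Fintype.card_fin, Fintype.card_fin, hNd]; push_cast; ring
  -- step 1: the norm is at most `(Nd·n)⁻¹·n·(Σ a + Σ b)`
  have hw1 : ∀ r : Fin P.d → Fin (P.L ^ k), ‖((r c.dir : ℕ) + 1) • (X ⟨Site.fibreSite 0 k c.src r, c.dir⟩ - C)‖ ≤ (P.L : ℝ) ^ k * a r := by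
    intro r
    refine norm_nsmul_le.trans ?_
    refine mul_le_mul_of_nonneg_right ?_ (norm_nonneg _)
    have : (r c.dir : ℕ) + 1 ≤ P.L ^ k := (r c.dir).isLt
    exact_mod_cast this
  have hw2 : ∀ r : Fin P.d → Fin (P.L ^ k),
      ‖(P.L ^ k - 1 - (r c.dir : ℕ)) • (X ⟨Site.fibreSite 0 k (runSite c.src c.dir 1) r, c.dir⟩ - C)‖ ≤ (P.L : ℝ) ^ k * b r := by
    intro r
    refine norm_nsmul_le.trans ?_
    refine mul_le_mul_of_nonneg_right ?_ (norm_nonneg _)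
    have : P.L ^ k - 1 - (r c.dir : ℕ) ≤ P.L ^ k := by omega
    exact_mod_cast this
  have hLk : (0 : ℝ) < (P.L : ℝ) ^ k := by positivity
  have hnorm : ‖bondAvgIter k X c - C‖ ≤ (Nd * (P.L : ℝ) ^ k)⁻¹ * ((P.L : ℝ) ^ k * (∑ r, a r + ∑ r, b r)) := by
    have hprod : (0 : ℝ) < ((P.L : ℝ) ^ k) ^ P.d * (P.L : ℝ) ^ k := by positivity
    rw [bondAvgIter_sub_const_eq_tent hk h X c C, norm_smul, Real.norm_eq_abs, abs_of_pos (inv_pos.mpr hprod)]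
    refine mul_le_mul_of_nonneg_left ?_ (le_of_lt (inv_pos.mpr (mul_pos hNd0 hLk)))
    refine (norm_add_le _ _).trans ?_
    rw [mul_add, Finset.mul_sum, Finset.mul_sum]
    exact add_le_add ((norm_sum_le _ _).trans (Finset.sum_le_sum fun r _ => hw1 r))
      ((norm_sum_le _ _).trans (Finset.sum_le_sum fun r _ => hw2 r))
  have hsimp : (Nd * (P.L : ℝ) ^ k)⁻¹ * ((P.L : ℝ) ^ k * (∑ r, a r + ∑ r, b r)) = Nd⁻¹ * (∑ r, a r + ∑ r, b r) := by
    field_simp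
  rw [hsimp] at hnorm
  -- step 2: square and Cauchy–Schwarz over the `Nd` offsets
  have hA : (∑ r, a r) ^ 2 ≤ Nd * ∑ r, a r ^ 2 := by
    have := sq_sum_le_card_mul_sum_sq (s := (Finset.univ : Finset (Fin P.d → Fin (P.L ^ k)))) (f := a)
    rwa [Finset.card_univ, hcard] at this
  have hB : (∑ r, b r) ^ 2 ≤ Nd * ∑ r, b r ^ 2 := by
    have := sq_sum_le_card_mul_sum_sq (s := (Finset.univ : Finset (Fin P.d → Fin (P.L ^ k)))) (f := b)
    rwa [Finset.card_univ, hcard] at this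
  have hpos : 0 ≤ Nd⁻¹ * (∑ r, a r + ∑ r, b r) :=
    mul_nonneg (by positivity) (add_nonneg (Finset.sum_nonneg fun r _ => norm_nonneg _) (Finset.sum_nonneg fun r _ => norm_nonneg _))
  calc ‖bondAvgIter k X c - C‖ ^ 2 ≤ (Nd⁻¹ * (∑ r, a r + ∑ r, b r)) ^ 2 :=
        pow_le_pow_left₀ (norm_nonneg _) hnorm 2
    _ = Nd⁻¹ * (Nd⁻¹ * (∑ r, a r + ∑ r, b r) ^ 2) := by ring
    _ ≤ Nd⁻¹ * (Nd⁻¹ * (2 * (∑ r, a r) ^ 2 + 2 * (∑ r, b r) ^ 2)) := by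
        refine mul_le_mul_of_nonneg_left (mul_le_mul_of_nonneg_left ?_ (by positivity)) (by positivity)
        nlinarith [sq_nonneg (∑ r, a r - ∑ r, b r)]
    _ ≤ Nd⁻¹ * (Nd⁻¹ * (2 * (Nd * ∑ r, a r ^ 2) + 2 * (Nd * ∑ r, b r ^ 2))) := by
        refine mul_le_mul_of_nonneg_left (mul_le_mul_of_nonneg_left ?_ (by positivity)) (by positivity)
        linarith
    _ = 2 * Nd⁻¹ * (∑ r, a r ^ 2 + ∑ r, b r ^ 2) := by
        field_simp

end Summit.QuantumFields.YangMills.Theorems.Prop7BondAvgIterOsc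

end
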